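import Summits.ValiantsHypothesis.ValiantsHypothesis.Theorems.LacunarySymmetroidMatrixDescartesCensusTwoRowBoxLeaf
import Summits.ValiantsHypothesis.ValiantsHypothesis.Theorems.LacunarySymmetroidMatrixDescartesCensusSignVariationsFewnomial

/-!
# `MatrixDescartes` census — W4 boundary layer, kernel kit: TWO-ROW-BOX LEAF, part 1b — the Descartes variant

HONEST FRAMING — as in `…CensusTwoRowBoxLeaf` (library file, engine-1 g25, O4 / R1945 / R1950; item `DoorA26 = PosRootLawAt 2 6 19`,
stmt-ValiantsHypothesis-19979, OPEN, typed, never asserted).  The «(V) leaf» of HYBRID27 §1: for `P = Σ_j A_j X^{a+d_j} − Σ_j B_j X^{b+d_j}`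
(`B₁ > 0`, other `B_j ≥ 0`) the COLLECTED Wronskian `N(x) = Σ_{t<M} K_t x^{s_t}` (exponents strictly increasing on `range M`, all
`K_t ≠ 0`, and the identity `N(x) = Φ(x^{d₁},…,x^{d_m})` — `ring` at the instance) bounds `#Z₊^{mult}(P) ≤ #{t : K_tK_{t+1} < 0} + 1`
by quotient Rolle (`countP_posRoots_le_wronskian_add_one`), Euler (`x·W(x) = x^{a+b}N(x)` hence `X·W = X^{a+b}·N` as polynomials),
Descartes' rule of signs (Mathlib `roots_countP_pos_le_signVariations`) and `signVariations_rsum` (…CensusSignVariationsFewnomial).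
The emitter decides each indicator `[K_tK_{t+1} < 0]` from its sign facts.  Nothing here bounds `ζ_sym(2,6)`, decides `DoorA26`, or
bears on `MatrixDescartes` (stmt-ValiantsHypothesis-18050) / `VP ≠ VNP`.

[folklore] Quotient Rolle + Euler's operator + Descartes' rule of signs; no single source.
-/

set_option linter.dupNamespace false

namespace Summit.ValiantsHypothesis.ValiantsHypothesis.Theorems.LacunarySymmetroidMatrixDescartes.Census

open Polynomial Finset
open scoped BigOperators Polynomial

/-! ### The Descartes variant: sign changes of the collected Wronskian -/

/-- **Two-row box leaf, Descartes variant, `m = 2` columns.**  With `P = Σ_j A_j X^{a+d_j} − Σ_j B_j X^{b+d_j}` (`B₁ > 0`, other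
`B_j ≥ 0`), let the COLLECTED Wronskian be given as a fewnomial `N(x) = Σ_{t<M} K_t x^{s_t}` (`s` strictly increasing on
`range M`, all `K_t ≠ 0`) with `N(x) = Φ(x^{d₁},…)` for all real `x` (`Φ` the Wronskian form; the identity is `ring` for the
emitter).  Then `#Z₊^{mult}(P) ≤ #{t < M−1 : K_t K_{t+1} < 0} + 1` (quotient Rolle + Euler + Descartes' rule of signs). [folklore] -/
theorem countP_posRoots_twoRow₂_le_signChanges_add_one (A₁ A₂ B₁ B₂ : ℝ) (a b d₁ d₂ : ℕ)
    (hB₁ : 0 < B₁) (hB₂ : 0 ≤ B₂)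
    (M : ℕ) (hM : 1 ≤ M) (K : ℕ → ℝ) (s : ℕ → ℕ) (hs : ∀ i j, i < j → j < M → s i < s j)
    (hK : ∀ t, t < M → K t ≠ 0)
    (hNW : ∀ x : ℝ, (∑ t ∈ range M, K t * x ^ (s t)) = A₁ * B₁ * ((a : ℝ) + d₁ - ((b : ℝ) + d₁)) * (x ^ d₁ * x ^ d₁) + A₁ * B₂ * ((a : ℝ) + d₁ - ((b : ℝ) + d₂)) * (x ^ d₁ * x ^ d₂) + A₂ * B₁ * ((a : ℝ) + d₂ - ((b : ℝ) + d₁)) * (x ^ d₂ * x ^ d₁) + A₂ * B₂ * ((a : ℝ) + d₂ - ((b : ℝ) + d₂)) * (x ^ d₂ * x ^ d₂)) :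
    (C A₁ * X ^ (a + d₁) + C A₂ * X ^ (a + d₂) - (C B₁ * X ^ (b + d₁) + C B₂ * X ^ (b + d₂)) : ℝ[X]).roots.countP (fun x => 0 < x)
      ≤ (∑ t ∈ range (M - 1), (if K t * K (t + 1) < 0 then 1 else 0)) + 1 := by
  classical
  set P : ℝ[X] := C A₁ * X ^ (a + d₁) + C A₂ * X ^ (a + d₂) - (C B₁ * X ^ (b + d₁) + C B₂ * X ^ (b + d₂)) with hP_def
  set g : ℝ[X] := (C B₁ * X ^ (b + d₁) + C B₂ * X ^ (b + d₂) : ℝ[X]) with hg_def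
  set W : ℝ[X] := g * derivative P - P * derivative g with hW_def
  have hXP : (X : ℝ[X]) * derivative P = C (A₁ * ((a + d₁ : ℕ) : ℝ)) * X ^ (a + d₁) + C (A₂ * ((a + d₂ : ℕ) : ℝ)) * X ^ (a + d₂) - (C (B₁ * ((b + d₁ : ℕ) : ℝ)) * X ^ (b + d₁) + C (B₂ * ((b + d₂ : ℕ) : ℝ)) * X ^ (b + d₂)) := by
    simp only [hP_def, hg_def, derivative_add, derivative_sub, mul_add, mul_sub, X_mul_derivative_C_mul_X_pow]
  have hXg : (X : ℝ[X]) * derivative g = C (B₁ * ((b + d₁ : ℕ) : ℝ)) * X ^ (b + d₁) + C (B₂ * ((b + d₂ : ℕ) : ℝ)) * X ^ (b + d₂) := by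
    simp only [hg_def, derivative_add, mul_add, X_mul_derivative_C_mul_X_pow]
  have hev : ∀ x : ℝ, ((X : ℝ[X]) * W).eval x = x ^ a * x ^ b * (A₁ * B₁ * ((a : ℝ) + d₁ - ((b : ℝ) + d₁)) * (x ^ d₁ * x ^ d₁) + A₁ * B₂ * ((a : ℝ) + d₁ - ((b : ℝ) + d₂)) * (x ^ d₁ * x ^ d₂) + A₂ * B₁ * ((a : ℝ) + d₂ - ((b : ℝ) + d₁)) * (x ^ d₂ * x ^ d₁) + A₂ * B₂ * ((a : ℝ) + d₂ - ((b : ℝ) + d₂)) * (x ^ d₂ * x ^ d₂)) := by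
    intro x
    have h2 : (X : ℝ[X]) * W = g * (X * derivative P) - P * (X * derivative g) := by rw [hW_def]; ring
    rw [h2, hXP, hXg, hP_def, hg_def]
    simp only [eval_add, eval_sub, eval_mul, eval_C, eval_pow, eval_X]
    push_cast
    ring
  -- the strictly increasing extension of `s` to all of ℕ and the collected Wronskian `N`
  set s' : ℕ → ℕ := fun t => if t < M then s t else s (M - 1) + t with hs'_def
  have hs's : ∀ t, t < M → s' t = s t := by intro t ht; simp [hs'_def, ht]
  have hs'mono : StrictMono s' := by
    refine strictMono_nat_of_lt_succ fun t => ?_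
    by_cases h1 : t + 1 < M
    · rw [hs's t (by omega), hs's (t + 1) h1]; exact hs t (t + 1) (by omega) h1
    · by_cases h0 : t < M
      · have htM : t = M - 1 := by omega
        rw [hs's t h0]; simp only [hs'_def, if_neg h1]; rw [htM]; omega
      · simp only [hs'_def, if_neg h0, if_neg h1]; omega
  set N : ℝ[X] := ∑ t ∈ range M, C (K t) * X ^ (s' t) with hN_def
  have hNeval : ∀ x : ℝ, N.eval x = ∑ t ∈ range M, K t * x ^ (s t) := by
    intro x
    rw [hN_def, eval_finsetSum]
    refine Finset.sum_congr rfl fun t ht => ?_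
    rw [Finset.mem_range] at ht
    simp only [eval_mul, eval_C, eval_pow, eval_X, hs's t ht]
  have hN0 : N ≠ 0 := rsum_ne_zero hM s' hs'mono K (hK (M - 1) (by omega))
  -- X·W = X^{a+b}·N as polynomials (they agree at every real)
  have hXW : (X : ℝ[X]) * W = X ^ (a + b) * N := by
    apply Polynomial.funext
    intro x
    rw [hev x, eval_mul, eval_pow, eval_X, hNeval x, hNW x, pow_add]
  have hW0 : W ≠ 0 := by
    intro h0
    have : (X : ℝ[X]) ^ (a + b) * N = 0 := by rw [← hXW, h0, mul_zero]
    exact (mul_ne_zero (pow_ne_zero _ X_ne_zero) hN0) this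
  have hWN : W.roots.countP (fun x => 0 < x) = N.roots.countP (fun x => 0 < x) := by
    have h1 := countP_posRoots_X_pow_mul W 1
    rw [pow_one, hXW] at h1
    rw [← h1, countP_posRoots_X_pow_mul N (a + b)]
  have hgpos : ∀ x : ℝ, 0 < x → g.eval x ≠ 0 := by
    intro x hx
    have hx1 : 0 < B₁ * x ^ (b + d₁) := mul_pos hB₁ (pow_pos hx _)
    have hx2 : 0 ≤ B₂ * x ^ (b + d₂) := mul_nonneg hB₂ (pow_pos hx _).le
    have : 0 < g.eval x := by
      rw [hg_def]
      simp only [eval_add, eval_mul, eval_C, eval_pow, eval_X]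
      linarith
    exact this.ne'
  have main := countP_posRoots_le_wronskian_add_one P g W hW_def hW0 hgpos
  have hDes : N.roots.countP (fun x => 0 < x) ≤ N.signVariations := N.roots_countP_pos_le_signVariations
  have hSV : N.signVariations = ∑ t ∈ range (M - 1), (if K t * K (t + 1) < 0 then 1 else 0) :=
    signVariations_rsum M hM s' hs'mono K hK
  rw [hWN] at main
  calc P.roots.countP (fun x => 0 < x) ≤ N.roots.countP (fun x => 0 < x) + 1 := main
    _ ≤ N.signVariations + 1 := by omega
    _ = _ := by rw [hSV]

/-- **Two-row box leaf, Descartes variant, `m = 3` columns.**  With `P = Σ_j A_j X^{a+d_j} − Σ_j B_j X^{b+d_j}` (`B₁ > 0`, other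
`B_j ≥ 0`), let the COLLECTED Wronskian be given as a fewnomial `N(x) = Σ_{t<M} K_t x^{s_t}` (`s` strictly increasing on
`range M`, all `K_t ≠ 0`) with `N(x) = Φ(x^{d₁},…)` for all real `x` (`Φ` the Wronskian form; the identity is `ring` for the
emitter).  Then `#Z₊^{mult}(P) ≤ #{t < M−1 : K_t K_{t+1} < 0} + 1` (quotient Rolle + Euler + Descartes' rule of signs). [folklore] -/
theorem countP_posRoots_twoRow₃_le_signChanges_add_one (A₁ A₂ A₃ B₁ B₂ B₃ : ℝ) (a b d₁ d₂ d₃ : ℕ)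
    (hB₁ : 0 < B₁) (hB₂ : 0 ≤ B₂) (hB₃ : 0 ≤ B₃)
    (M : ℕ) (hM : 1 ≤ M) (K : ℕ → ℝ) (s : ℕ → ℕ) (hs : ∀ i j, i < j → j < M → s i < s j)
    (hK : ∀ t, t < M → K t ≠ 0)
    (hNW : ∀ x : ℝ, (∑ t ∈ range M, K t * x ^ (s t)) = A₁ * B₁ * ((a : ℝ) + d₁ - ((b : ℝ) + d₁)) * (x ^ d₁ * x ^ d₁) + A₁ * B₂ * ((a : ℝ) + d₁ - ((b : ℝ) + d₂)) * (x ^ d₁ * x ^ d₂) + A₁ * B₃ * ((a : ℝ) + d₁ - ((b : ℝ) + d₃)) * (x ^ d₁ * x ^ d₃) + A₂ * B₁ * ((a : ℝ) + d₂ - ((b : ℝ) + d₁)) * (x ^ d₂ * x ^ d₁) + A₂ * B₂ * ((a : ℝ) + d₂ - ((b : ℝ) + d₂)) * (x ^ d₂ * x ^ d₂) + A₂ * B₃ * ((a : ℝ) + d₂ - ((b : ℝ) + d₃)) * (x ^ d₂ * x ^ d₃) + A₃ * B₁ * ((a : ℝ) + d₃ - ((b : ℝ) + d₁)) * (x ^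 d₃ * x ^ d₁) + A₃ * B₂ * ((a : ℝ) + d₃ - ((b : ℝ) + d₂)) * (x ^ d₃ * x ^ d₂) + A₃ * B₃ * ((a : ℝ) + d₃ - ((b : ℝ) + d₃)) * (x ^ d₃ * x ^ d₃)) :
    (C A₁ * X ^ (a + d₁) + C A₂ * X ^ (a + d₂) + C A₃ * X ^ (a + d₃) - (C B₁ * X ^ (b + d₁) + C B₂ * X ^ (b + d₂) + C B₃ * X ^ (b + d₃)) : ℝ[X]).roots.countP (fun x => 0 < x)
      ≤ (∑ t ∈ range (M - 1), (if K t * K (t + 1) < 0 then 1 else 0)) + 1 := by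
  classical
  set P : ℝ[X] := C A₁ * X ^ (a + d₁) + C A₂ * X ^ (a + d₂) + C A₃ * X ^ (a + d₃) - (C B₁ * X ^ (b + d₁) + C B₂ * X ^ (b + d₂) + C B₃ * X ^ (b + d₃)) with hP_def
  set g : ℝ[X] := (C B₁ * X ^ (b + d₁) + C B₂ * X ^ (b + d₂) + C B₃ * X ^ (b + d₃) : ℝ[X]) with hg_def
  set W : ℝ[X] := g * derivative P - P * derivative g with hW_def
  have hXP : (X : ℝ[X]) * derivative P = C (A₁ * ((a + d₁ : ℕ) : ℝ)) * X ^ (a + d₁) + C (A₂ * ((a + d₂ : ℕ) : ℝ)) * X ^ (a + d₂) + C (A₃ * ((a + d₃ : ℕ) : ℝ)) * X ^ (a + d₃) - (C (B₁ * ((b + d₁ : ℕ) : ℝ)) * X ^ (b + d₁) + C (B₂ * ((b + d₂ : ℕ) : ℝ)) * X ^ (b + d₂) + C (B₃ * ((b + d₃ : ℕ) : ℝ)) * X ^ (b + d₃)) := by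
    simp only [hP_def, hg_def, derivative_add, derivative_sub, mul_add, mul_sub, X_mul_derivative_C_mul_X_pow]
  have hXg : (X : ℝ[X]) * derivative g = C (B₁ * ((b + d₁ : ℕ) : ℝ)) * X ^ (b + d₁) + C (B₂ * ((b + d₂ : ℕ) : ℝ)) * X ^ (b + d₂) + C (B₃ * ((b + d₃ : ℕ) : ℝ)) * X ^ (b + d₃) := by
    simp only [hg_def, derivative_add, mul_add, X_mul_derivative_C_mul_X_pow]
  have hev : ∀ x : ℝ, ((X : ℝ[X]) * W).eval x = x ^ a * x ^ b * (A₁ * B₁ * ((a : ℝ) + d₁ - ((b : ℝ) + d₁)) * (x ^ d₁ * x ^ d₁) + A₁ * B₂ * ((a : ℝ) + d₁ - ((b : ℝ) + d₂)) * (x ^ d₁ * x ^ d₂) + A₁ * B₃ * ((a : ℝ) + d₁ - ((b : ℝ) + d₃)) * (x ^ d₁ * x ^ d₃) + A₂ * B₁ * ((a : ℝ) + d₂ - ((b : ℝ) + d₁)) * (x ^ d₂ * x ^ d₁) + A₂ * B₂ * ((a : ℝ) + d₂ - ((b : ℝ) + d₂)) * (x ^ d₂ * x ^ d₂) + A₂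 * B₃ * ((a : ℝ) + d₂ - ((b : ℝ) + d₃)) * (x ^ d₂ * x ^ d₃) + A₃ * B₁ * ((a : ℝ) + d₃ - ((b : ℝ) + d₁)) * (x ^ d₃ * x ^ d₁) + A₃ * B₂ * ((a : ℝ) + d₃ - ((b : ℝ) + d₂)) * (x ^ d₃ * x ^ d₂) + A₃ * B₃ * ((a : ℝ) + d₃ - ((b : ℝ) + d₃)) * (x ^ d₃ * x ^ d₃)) := by
    intro x
    have h2 : (X : ℝ[X]) * W = g * (X * derivative P) - P * (X * derivative g) := by rw [hW_def]; ring
    rw [h2, hXP, hXg, hP_def, hg_def]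
    simp only [eval_add, eval_sub, eval_mul, eval_C, eval_pow, eval_X]
    push_cast
    ring
  -- the strictly increasing extension of `s` to all of ℕ and the collected Wronskian `N`
  set s' : ℕ → ℕ := fun t => if t < M then s t else s (M - 1) + t with hs'_def
  have hs's : ∀ t, t < M → s' t = s t := by intro t ht; simp [hs'_def, ht]
  have hs'mono : StrictMono s' := by
    refine strictMono_nat_of_lt_succ fun t => ?_
    by_cases h1 : t + 1 < M
    · rw [hs's t (by omega), hs's (t + 1) h1]; exact hs t (t + 1) (by omega) h1
    · by_cases h0 : t < M
      · have htM : t = M - 1 := by omega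
        rw [hs's t h0]; simp only [hs'_def, if_neg h1]; rw [htM]; omega
      · simp only [hs'_def, if_neg h0, if_neg h1]; omega
  set N : ℝ[X] := ∑ t ∈ range M, C (K t) * X ^ (s' t) with hN_def
  have hNeval : ∀ x : ℝ, N.eval x = ∑ t ∈ range M, K t * x ^ (s t) := by
    intro x
    rw [hN_def, eval_finsetSum]
    refine Finset.sum_congr rfl fun t ht => ?_
    rw [Finset.mem_range] at ht
    simp only [eval_mul, eval_C, eval_pow, eval_X, hs's t ht]
  have hN0 : N ≠ 0 := rsum_ne_zero hM s' hs'mono K (hK (M - 1) (by omega))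
  -- X·W = X^{a+b}·N as polynomials (they agree at every real)
  have hXW : (X : ℝ[X]) * W = X ^ (a + b) * N := by
    apply Polynomial.funext
    intro x
    rw [hev x, eval_mul, eval_pow, eval_X, hNeval x, hNW x, pow_add]
  have hW0 : W ≠ 0 := by
    intro h0
    have : (X : ℝ[X]) ^ (a + b) * N = 0 := by rw [← hXW, h0, mul_zero]
    exact (mul_ne_zero (pow_ne_zero _ X_ne_zero) hN0) this
  have hWN : W.roots.countP (fun x => 0 < x) = N.roots.countP (fun x => 0 < x) := by
    have h1 := countP_posRoots_X_pow_mul W 1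
    rw [pow_one, hXW] at h1
    rw [← h1, countP_posRoots_X_pow_mul N (a + b)]
  have hgpos : ∀ x : ℝ, 0 < x → g.eval x ≠ 0 := by
    intro x hx
    have hx1 : 0 < B₁ * x ^ (b + d₁) := mul_pos hB₁ (pow_pos hx _)
    have hx2 : 0 ≤ B₂ * x ^ (b + d₂) := mul_nonneg hB₂ (pow_pos hx _).le
    have hx3 : 0 ≤ B₃ * x ^ (b + d₃) := mul_nonneg hB₃ (pow_pos hx _).le
    have : 0 < g.eval x := by
      rw [hg_def]
      simp only [eval_add, eval_mul, eval_C, eval_pow, eval_X]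
      linarith
    exact this.ne'
  have main := countP_posRoots_le_wronskian_add_one P g W hW_def hW0 hgpos
  have hDes : N.roots.countP (fun x => 0 < x) ≤ N.signVariations := N.roots_countP_pos_le_signVariations
  have hSV : N.signVariations = ∑ t ∈ range (M - 1), (if K t * K (t + 1) < 0 then 1 else 0) :=
    signVariations_rsum M hM s' hs'mono K hK
  rw [hWN] at main
  calc P.roots.countP (fun x => 0 < x) ≤ N.roots.countP (fun x => 0 < x) + 1 := main
    _ ≤ N.signVariations + 1 := by omega
    _ = _ := by rw [hSV]

/-- **Two-row box leaf, Descartes variant, `m = 4` columns.**  With `P = Σ_j A_j X^{a+d_j} − Σ_j B_j X^{b+d_j}` (`B₁ > 0`, other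
`B_j ≥ 0`), let the COLLECTED Wronskian be given as a fewnomial `N(x) = Σ_{t<M} K_t x^{s_t}` (`s` strictly increasing on
`range M`, all `K_t ≠ 0`) with `N(x) = Φ(x^{d₁},…)` for all real `x` (`Φ` the Wronskian form; the identity is `ring` for the
emitter).  Then `#Z₊^{mult}(P) ≤ #{t < M−1 : K_t K_{t+1} < 0} + 1` (quotient Rolle + Euler + Descartes' rule of signs). [folklore] -/
theorem countP_posRoots_twoRow₄_le_signChanges_add_one (A₁ A₂ A₃ A₄ B₁ B₂ B₃ B₄ : ℝ) (a b d₁ d₂ d₃ d₄ : ℕ)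
    (hB₁ : 0 < B₁) (hB₂ : 0 ≤ B₂) (hB₃ : 0 ≤ B₃) (hB₄ : 0 ≤ B₄)
    (M : ℕ) (hM : 1 ≤ M) (K : ℕ → ℝ) (s : ℕ → ℕ) (hs : ∀ i j, i < j → j < M → s i < s j)
    (hK : ∀ t, t < M → K t ≠ 0)
    (hNW : ∀ x : ℝ, (∑ t ∈ range M, K t * x ^ (s t)) = A₁ * B₁ * ((a : ℝ) + d₁ - ((b : ℝ) + d₁)) * (x ^ d₁ * x ^ d₁) + A₁ * B₂ * ((a : ℝ) + d₁ - ((b : ℝ) + d₂)) * (x ^ d₁ * x ^ d₂) + A₁ * B₃ * ((a : ℝ) + d₁ - ((b : ℝ) + d₃)) * (x ^ d₁ * x ^ d₃) + A₁ * B₄ * ((a : ℝ) + d₁ - ((b : ℝ) + d₄)) * (x ^ d₁ * x ^ d₄) + A₂ * B₁ * ((a : ℝ) + d₂ - ((b : ℝ) + d₁)) * (x ^ d₂ * x ^ d₁) + A₂ * B₂ * ((a : ℝ) + d₂ - ((b : ℝ) + d₂)) * (x ^ d₂ * x ^ d₂) + A₂ * B₃ * ((a : ℝ) + d₂ - ((b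 : ℝ) + d₃)) * (x ^ d₂ * x ^ d₃) + A₂ * B₄ * ((a : ℝ) + d₂ - ((b : ℝ) + d₄)) * (x ^ d₂ * x ^ d₄) + A₃ * B₁ * ((a : ℝ) + d₃ - ((b : ℝ) + d₁)) * (x ^ d₃ * x ^ d₁) + A₃ * B₂ * ((a : ℝ) + d₃ - ((b : ℝ) + d₂)) * (x ^ d₃ * x ^ d₂) + A₃ * B₃ * ((a : ℝ) + d₃ - ((b : ℝ) + d₃)) * (x ^ d₃ * x ^ d₃) + A₃ * B₄ * ((a : ℝ) + d₃ - ((b : ℝ) + d₄)) * (x ^ d₃ * x ^ d₄) + A₄ * B₁ * ((a : ℝ) + d₄ - ((b : ℝ) + d₁)) * (x ^ d₄ * x ^ d₁) + A₄ * B₂ * ((a : ℝ) + d₄ - ((b : ℝ) + d₂)) * (x ^ d₄ * x ^ d₂) + A₄ * B₃ * ((a : ℝ) + d₄ - ((b : ℝ) + d₃)) * (x ^ d₄ * x ^ d₃) + A₄ * B₄ * ((a : ℝ) + d₄ - ((b : ℝ) + d₄)) * (x ^ d₄ * x ^ d₄)) :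
    (C A₁ * X ^ (a + d₁) + C A₂ * X ^ (a + d₂) + C A₃ * X ^ (a + d₃) + C A₄ * X ^ (a + d₄) - (C B₁ * X ^ (b + d₁) + C B₂ * X ^ (b + d₂) + C B₃ * X ^ (b + d₃) + C B₄ * X ^ (b + d₄)) : ℝ[X]).roots.countP (fun x => 0 < x)
      ≤ (∑ t ∈ range (M - 1), (if K t * K (t + 1) < 0 then 1 else 0)) + 1 := by
  classical
  set P : ℝ[X] := C A₁ * X ^ (a + d₁) + C A₂ * X ^ (a + d₂) + C A₃ * X ^ (a + d₃) + C A₄ * X ^ (a + d₄) - (C B₁ * X ^ (b + d₁) + C B₂ * X ^ (b + d₂) + C B₃ * X ^ (b + d₃) + C B₄ * X ^ (b + d₄)) with hP_def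
  set g : ℝ[X] := (C B₁ * X ^ (b + d₁) + C B₂ * X ^ (b + d₂) + C B₃ * X ^ (b + d₃) + C B₄ * X ^ (b + d₄) : ℝ[X]) with hg_def
  set W : ℝ[X] := g * derivative P - P * derivative g with hW_def
  have hXP : (X : ℝ[X]) * derivative P = C (A₁ * ((a + d₁ : ℕ) : ℝ)) * X ^ (a + d₁) + C (A₂ * ((a + d₂ : ℕ) : ℝ)) * X ^ (a + d₂) + C (A₃ * ((a + d₃ : ℕ) : ℝ)) * X ^ (a + d₃) + C (A₄ * ((a + d₄ : ℕ) : ℝ)) * X ^ (a + d₄) - (C (B₁ * ((b + d₁ : ℕ) : ℝ)) * X ^ (b + d₁) + C (B₂ * ((b + d₂ : ℕ) : ℝ)) * X ^ (b + d₂) + C (B₃ * ((b + d₃ : ℕ) : ℝ)) * X ^ (b + d₃) + C (B₄ * ((b + d₄ : ℕ) : ℝ)) * X ^ (b + d₄)) := by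
    simp only [hP_def, hg_def, derivative_add, derivative_sub, mul_add, mul_sub, X_mul_derivative_C_mul_X_pow]
  have hXg : (X : ℝ[X]) * derivative g = C (B₁ * ((b + d₁ : ℕ) : ℝ)) * X ^ (b + d₁) + C (B₂ * ((b + d₂ : ℕ) : ℝ)) * X ^ (b + d₂) + C (B₃ * ((b + d₃ : ℕ) : ℝ)) * X ^ (b + d₃) + C (B₄ * ((b + d₄ : ℕ) : ℝ)) * X ^ (b + d₄) := by
    simp only [hg_def, derivative_add, mul_add, X_mul_derivative_C_mul_X_pow]
  have hev : ∀ x : ℝ, ((X : ℝ[X]) * W).eval x = x ^ a * x ^ b * (A₁ * B₁ * ((a : ℝ) + d₁ - ((b : ℝ) + d₁)) * (x ^ d₁ * x ^ d₁) + A₁ * B₂ * ((a : ℝ) + d₁ - ((b : ℝ) + d₂)) * (x ^ d₁ * x ^ d₂) + A₁ * B₃ * ((a : ℝ) + d₁ - ((b : ℝ) + d₃)) * (x ^ d₁ * x ^ d₃) + A₁ * B₄ * ((a : ℝ) + d₁ - ((b : ℝ) + d₄)) * (x ^ d₁ * x ^ d₄) + A₂ * B₁ * ((a : ℝ) + d₂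 - ((b : ℝ) + d₁)) * (x ^ d₂ * x ^ d₁) + A₂ * B₂ * ((a : ℝ) + d₂ - ((b : ℝ) + d₂)) * (x ^ d₂ * x ^ d₂) + A₂ * B₃ * ((a : ℝ) + d₂ - ((b : ℝ) + d₃)) * (x ^ d₂ * x ^ d₃) + A₂ * B₄ * ((a : ℝ) + d₂ - ((b : ℝ) + d₄)) * (x ^ d₂ * x ^ d₄) + A₃ * B₁ * ((a : ℝ) + d₃ - ((b : ℝ) + d₁)) * (x ^ d₃ * x ^ d₁) + A₃ * B₂ * ((a : ℝ) + d₃ - ((b : ℝ) + d₂)) * (x ^ d₃ * x ^ d₂) + A₃ * B₃ * ((a : ℝ) + d₃ - ((b : ℝ) + d₃)) * (x ^ d₃ * x ^ d₃) + A₃ * B₄ * ((a : ℝ) + d₃ - ((b : ℝ) + d₄)) * (x ^ d₃ * x ^ d₄) + A₄ * B₁ * ((a : ℝ) + d₄ - ((b : ℝ) + d₁)) * (x ^ d₄ * x ^ d₁) + A₄ * B₂ * ((a : ℝ) + d₄ - ((b : ℝ) + d₂)) * (x ^ d₄ * x ^ d₂) + A₄ * B₃ * ((a : ℝ) + d₄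 - ((b : ℝ) + d₃)) * (x ^ d₄ * x ^ d₃) + A₄ * B₄ * ((a : ℝ) + d₄ - ((b : ℝ) + d₄)) * (x ^ d₄ * x ^ d₄)) := by
    intro x
    have h2 : (X : ℝ[X]) * W = g * (X * derivative P) - P * (X * derivative g) := by rw [hW_def]; ring
    rw [h2, hXP, hXg, hP_def, hg_def]
    simp only [eval_add, eval_sub, eval_mul, eval_C, eval_pow, eval_X]
    push_cast
    ring
  -- the strictly increasing extension of `s` to all of ℕ and the collected Wronskian `N`
  set s' : ℕ → ℕ := fun t => if t < M then s t else s (M - 1) + t with hs'_def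
  have hs's : ∀ t, t < M → s' t = s t := by intro t ht; simp [hs'_def, ht]
  have hs'mono : StrictMono s' := by
    refine strictMono_nat_of_lt_succ fun t => ?_
    by_cases h1 : t + 1 < M
    · rw [hs's t (by omega), hs's (t + 1) h1]; exact hs t (t + 1) (by omega) h1
    · by_cases h0 : t < M
      · have htM : t = M - 1 := by omega
        rw [hs's t h0]; simp only [hs'_def, if_neg h1]; rw [htM]; omega
      · simp only [hs'_def, if_neg h0, if_neg h1]; omega
  set N : ℝ[X] := ∑ t ∈ range M, C (K t) * X ^ (s' t) with hN_def
  have hNeval : ∀ x : ℝ, N.eval x = ∑ t ∈ range M, K t * x ^ (s t) := by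
    intro x
    rw [hN_def, eval_finsetSum]
    refine Finset.sum_congr rfl fun t ht => ?_
    rw [Finset.mem_range] at ht
    simp only [eval_mul, eval_C, eval_pow, eval_X, hs's t ht]
  have hN0 : N ≠ 0 := rsum_ne_zero hM s' hs'mono K (hK (M - 1) (by omega))
  -- X·W = X^{a+b}·N as polynomials (they agree at every real)
  have hXW : (X : ℝ[X]) * W = X ^ (a + b) * N := by
    apply Polynomial.funext
    intro x
    rw [hev x, eval_mul, eval_pow, eval_X, hNeval x, hNW x, pow_add]
  have hW0 : W ≠ 0 := by
    intro h0
    have : (X : ℝ[X]) ^ (a + b) * N = 0 := by rw [← hXW, h0, mul_zero]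
    exact (mul_ne_zero (pow_ne_zero _ X_ne_zero) hN0) this
  have hWN : W.roots.countP (fun x => 0 < x) = N.roots.countP (fun x => 0 < x) := by
    have h1 := countP_posRoots_X_pow_mul W 1
    rw [pow_one, hXW] at h1
    rw [← h1, countP_posRoots_X_pow_mul N (a + b)]
  have hgpos : ∀ x : ℝ, 0 < x → g.eval x ≠ 0 := by
    intro x hx
    have hx1 : 0 < B₁ * x ^ (b + d₁) := mul_pos hB₁ (pow_pos hx _)
    have hx2 : 0 ≤ B₂ * x ^ (b + d₂) := mul_nonneg hB₂ (pow_pos hx _).le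
    have hx3 : 0 ≤ B₃ * x ^ (b + d₃) := mul_nonneg hB₃ (pow_pos hx _).le
    have hx4 : 0 ≤ B₄ * x ^ (b + d₄) := mul_nonneg hB₄ (pow_pos hx _).le
    have : 0 < g.eval x := by
      rw [hg_def]
      simp only [eval_add, eval_mul, eval_C, eval_pow, eval_X]
      linarith
    exact this.ne'
  have main := countP_posRoots_le_wronskian_add_one P g W hW_def hW0 hgpos
  have hDes : N.roots.countP (fun x => 0 < x) ≤ N.signVariations := N.roots_countP_pos_le_signVariations
  have hSV : N.signVariations = ∑ t ∈ range (M - 1), (if K t * K (t + 1) < 0 then 1 else 0) :=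
    signVariations_rsum M hM s' hs'mono K hK
  rw [hWN] at main
  calc P.roots.countP (fun x => 0 < x) ≤ N.roots.countP (fun x => 0 < x) + 1 := main
    _ ≤ N.signVariations + 1 := by omega
    _ = _ := by rw [hSV]

/-! ### Signs of the collected coefficients from the ν-box (for the emitter's `hK` and indicator facts)

Appended by engine-1 g25 (same seat, same day): with the ν-box hypotheses of the SDD certificate
(`lo_j B_j κ_d ≤ κ_n A_j ≤ hi_j B_j κ_d`, `κ_n, κ_d, B_j > 0`), the SIGN of a collected cross coefficient
`A_j B_k c + A_k B_j c'` (`c = (a+d_j) − (b+d_k)`, `c' = (a+d_k) − (b+d_j)`) is decided by four NUMERIC corner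
inequalities, and a diagonal coefficient is always negative — so a (V) leaf needs no letter arithmetic beyond the box. -/

/-- **Cross coefficient NEGATIVE from the box corners.** [folklore] -/
theorem cross_coeff_neg_of_corners {κn κd Aj Ak Bj Bk loj hij lok hik c c' : ℝ} (hκn : 0 < κn) (hκd : 0 < κd)
    (hBj : 0 < Bj) (hBk : 0 < Bk)
    (hloj : loj * Bj * κd ≤ κn * Aj) (hhij : κn * Aj ≤ hij * Bj * κd)
    (hlok : lok * Bk * κd ≤ κn * Ak) (hhik : κn * Ak ≤ hik * Bk * κd)
    (h1 : c * loj + c' * lok < 0) (h2 : c * loj + c' * hik < 0) (h3 : c * hij + c' * lok < 0)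
    (h4 : c * hij + c' * hik < 0) :
    Aj * Bk * c + Ak * Bj * c' < 0 := by
  have hBB : 0 < Bj * Bk := mul_pos hBj hBk
  -- κ_n · (target) = c·(κ_n A_j)·B_k + c'·(κ_n A_k)·B_j, bounded by a corner value times B_jB_kκ_d
  have key : κn * (Aj * Bk * c + Ak * Bj * c') < 0 := by
    rcases le_total 0 c with hc | hc <;> rcases le_total 0 c' with hc' | hc'
    · have ej : c * (κn * Aj) ≤ c * (hij * Bj * κd) := mul_le_mul_of_nonneg_left hhij hc
      have ek : c' * (κn * Ak) ≤ c' * (hik * Bk * κd) := mul_le_mul_of_nonneg_left hhik hc'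
      nlinarith [mul_le_mul_of_nonneg_right ej hBk.le, mul_le_mul_of_nonneg_right ek hBj.le,
        mul_neg_of_neg_of_pos h4 (mul_pos hBB hκd)]
    · have ej : c * (κn * Aj) ≤ c * (hij * Bj * κd) := mul_le_mul_of_nonneg_left hhij hc
      have ek : c' * (κn * Ak) ≤ c' * (lok * Bk * κd) := mul_le_mul_of_nonpos_left hlok hc'
      nlinarith [mul_le_mul_of_nonneg_right ej hBk.le, mul_le_mul_of_nonneg_right ek hBj.le,
        mul_neg_of_neg_of_pos h3 (mul_pos hBB hκd)]
    · have ej : c * (κn * Aj) ≤ c * (loj * Bj * κd) := mul_le_mul_of_nonpos_left hloj hc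
      have ek : c' * (κn * Ak) ≤ c' * (hik * Bk * κd) := mul_le_mul_of_nonneg_left hhik hc'
      nlinarith [mul_le_mul_of_nonneg_right ej hBk.le, mul_le_mul_of_nonneg_right ek hBj.le,
        mul_neg_of_neg_of_pos h2 (mul_pos hBB hκd)]
    · have ej : c * (κn * Aj) ≤ c * (loj * Bj * κd) := mul_le_mul_of_nonpos_left hloj hc
      have ek : c' * (κn * Ak) ≤ c' * (lok * Bk * κd) := mul_le_mul_of_nonpos_left hlok hc'
      nlinarith [mul_le_mul_of_nonneg_right ej hBk.le, mul_le_mul_of_nonneg_right ek hBj.le,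
        mul_neg_of_neg_of_pos h1 (mul_pos hBB hκd)]
  by_contra hcon
  have : 0 ≤ κn * (Aj * Bk * c + Ak * Bj * c') := mul_nonneg hκn.le (not_lt.mp hcon)
  linarith

/-- **Cross coefficient POSITIVE from the box corners.** [folklore] -/
theorem cross_coeff_pos_of_corners {κn κd Aj Ak Bj Bk loj hij lok hik c c' : ℝ} (hκn : 0 < κn) (hκd : 0 < κd)
    (hBj : 0 < Bj) (hBk : 0 < Bk)
    (hloj : loj * Bj * κd ≤ κn * Aj) (hhij : κn * Aj ≤ hij * Bj * κd)
    (hlok : lok * Bk * κd ≤ κn * Ak) (hhik : κn * Ak ≤ hik * Bk * κd)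
    (h1 : 0 < c * loj + c' * lok) (h2 : 0 < c * loj + c' * hik) (h3 : 0 < c * hij + c' * lok)
    (h4 : 0 < c * hij + c' * hik) :
    0 < Aj * Bk * c + Ak * Bj * c' := by
  have h := cross_coeff_neg_of_corners (c := -c) (c' := -c') hκn hκd hBj hBk hloj hhij hlok hhik
    (by linarith) (by linarith) (by linarith) (by linarith)
  linarith

/-- **Diagonal coefficient is negative** (`a < b`, `A_j, B_j > 0`). [folklore] -/
theorem diag_coeff_neg {Aj Bj : ℝ} {a b dj : ℕ} (hA : 0 < Aj) (hB : 0 < Bj) (hab : a < b) :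
    Aj * Bj * ((a : ℝ) + dj - ((b : ℝ) + dj)) < 0 := by
  have hab' : ((a : ℝ) + dj - ((b : ℝ) + dj)) < 0 := by
    have : (a : ℝ) < b := by exact_mod_cast hab
    linarith
  exact mul_neg_of_pos_of_neg (mul_pos hA hB) hab'

end Summit.ValiantsHypothesis.ValiantsHypothesis.Theorems.LacunarySymmetroidMatrixDescartes.Census
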